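import Mathlib
import Summits.KontsevichZagierPeriods.Zeta5Search.ClusterBoundProof
import HarnessLib

/-!
# ζ(5) search — local structure of the partial fractions of `R_b` at a TWO-POINT residue class

Cell `pub-zeta5` (HONEST FRAMING: systematic search; no irrationality claim unless certified), P1 prover seat
generation 5.  First file of the Lean proof of census g11's `RecordCellA` (the first minor-level valuation law on the
Brown–Zudilin record ray: `v_p(Cas₇(b_rec(n))) ≥ −4` for `14n < p < 15n`).  Nothing here is specific to the record ray:
for `b` in the polytope, a window prime `p` and a pole `q` whose residue class modulo `p` is `{q, r}` we factor the
regular part `Gser b q` of `R_b` at the pole (`ClusterBoundSeries`) as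

  `Gser b q = posFactor b q r · Gout b q r`,   `posFactor = (X + (r−q))^{mult r}·((X + (r−q))^6)⁻¹ "=" (X + (r−q))^{netExp r}`,

where `Gout b q r` (the centre factor times the factors of all positions OUTSIDE the class) has `p`-INTEGRAL coefficients
(`gout_integral`, the argument of `gser_integral`), so that `Gser b q · (X + (r−q))^m = Gout b q r` for `m = −netExp r`
(`gser_mul_linS_pow`) determines the first coefficients of `Gser b q` — hence the partial-fraction coefficients
`c_{o,q} = [X^{5−o}](X^{mult q}·Gser b q)` (`pf_eq_coeff_Gser`) — EXACTLY in terms of the integral coefficients of `Gout`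
(`coeff_of_mul_linS`, `…_sq`, `…_cube`).  Finally the constant terms of `Gout` at the two points `q₀`, `q₀ + p` of a
class are congruent modulo `p` (`padicNorm_goutConst_sub_le`: the same product of units, shifted by `p`).  The two class
types needed for the record cell are spelled out in part 2 (`RecordCellATwoPointPF.lean`).  Power-series algebra over `ℚ`
and `p`-adic norms of rational numbers; nothing about irrationality.
-/

noncomputable section

open Finset PowerSeries

namespace Summit.KontsevichZagierPeriods.Zeta5Search.CellA

open Summit.KontsevichZagierPeriods.Zeta5Search.DualSeries (InBox)
open Summit.KontsevichZagierPeriods.Zeta5Search.WedgeDictionary (IsPFData pfData)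
open Summit.KontsevichZagierPeriods.Zeta5Search.CasoratianValuation (InPolytope)
open Summit.KontsevichZagierPeriods.Zeta5Search.ClusterValuation
open Summit.KontsevichZagierPeriods.Zeta5Search.PadicSeries

variable {p : ℕ} [hp : Fact p.Prime]

/-! ### The factorisation `Gser = posFactor · Gout` -/

/-- The factor of the position `s` in `Gser b q`: `(X + (s−q))^{mult s} · ((X + (s−q))^6)⁻¹` (`= (X + (s−q))^{netExp s}`). -/
def posFactor (b : ℕ → ℤ) (q s : ℕ) : PowerSeries ℚ :=
  linS ((s : ℚ) - q) ^ mult b s * (linS ((s : ℚ) - q) ^ 6)⁻¹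

/-- `Gout b q r`: the regular part of `R_b` at the pole `q` with the factor of the class partner `r` REMOVED
(centre factor times the factors of all positions `s ∉ {q, r}`). -/
def Gout (b : ℕ → ℤ) (q r : ℕ) : PowerSeries ℚ :=
  (cenP b q : PowerSeries ℚ) * ∏ s ∈ ((range ((b 0).toNat + 1)).erase q).erase r, posFactor b q s

omit hp in
/-- `Gser b q = posFactor b q r · Gout b q r`. -/
theorem gser_eq_posFactor_mul_gout (b : ℕ → ℤ) {q r : ℕ} (hr : r ≤ (b 0).toNat) (hrq : r ≠ q) :
    Gser b q = posFactor b q r * Gout b q r := by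
  unfold Gser Gout
  have hmem : r ∈ (range ((b 0).toNat + 1)).erase q := mem_erase.2 ⟨hrq, mem_range.2 (by omega)⟩
  rw [← mul_prod_erase _ _ hmem]
  unfold posFactor
  ring

omit hp in
/-- `posFactor b q r · (X + (r−q))^m = 1` when `mult r + m = 6` (i.e. `m = −netExp r`). -/
theorem posFactor_mul_linS_pow (b : ℕ → ℤ) {q r : ℕ} (hrq : r ≠ q) {m : ℕ} (hm : mult b r + m = 6) :
    posFactor b q r * linS ((r : ℚ) - q) ^ m = 1 := by
  unfold posFactor
  have hδ : ((r : ℚ) - q) ≠ 0 := sub_ne_zero.2 (by exact_mod_cast hrq)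
  have h6 : constantCoeff (linS ((r : ℚ) - q) ^ 6) ≠ 0 := by
    rw [constantCoeff_linS_pow]; exact pow_ne_zero _ hδ
  calc linS ((r : ℚ) - q) ^ mult b r * (linS ((r : ℚ) - q) ^ 6)⁻¹ * linS ((r : ℚ) - q) ^ m
      = linS ((r : ℚ) - q) ^ (mult b r + m) * (linS ((r : ℚ) - q) ^ 6)⁻¹ := by rw [pow_add]; ring
    _ = 1 := by rw [hm, PowerSeries.mul_inv_cancel _ h6]

omit hp in
/-- **`Gser b q · (X + (r−q))^m = Gout b q r`** for the class partner `r` of pole order `m = 6 − mult r`. -/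
theorem gser_mul_linS_pow (b : ℕ → ℤ) {q r : ℕ} (hr : r ≤ (b 0).toNat) (hrq : r ≠ q) {m : ℕ}
    (hm : mult b r + m = 6) : Gser b q * linS ((r : ℚ) - q) ^ m = Gout b q r := by
  rw [gser_eq_posFactor_mul_gout b hr hrq, mul_right_comm, posFactor_mul_linS_pow b hrq hm, one_mul]

/-! ### Reading coefficients off `F · (X + δ)^m = G` -/

omit hp in
/-- `[X⁰](F·(X+δ)) = δ·[X⁰]F`. -/
theorem coeff_zero_mul_linS (F : PowerSeries ℚ) (δ : ℚ) : coeff 0 (F * linS δ) = δ * coeff 0 F := by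
  rw [linS, mul_add, map_add, PowerSeries.coeff_zero_mul_X, mul_comm F (C δ), PowerSeries.coeff_C_mul, zero_add]

omit hp in
/-- `[X^{k+1}](F·(X+δ)) = [X^k]F + δ·[X^{k+1}]F`. -/
theorem coeff_succ_mul_linS (F : PowerSeries ℚ) (δ : ℚ) (k : ℕ) :
    coeff (k + 1) (F * linS δ) = coeff k F + δ * coeff (k + 1) F := by
  rw [linS, mul_add, map_add, PowerSeries.coeff_succ_mul_X, mul_comm F (C δ), PowerSeries.coeff_C_mul]

omit hp in
/-- From `F·(X+δ) = G` (`δ ≠ 0`): the first three coefficients of `F`. -/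
theorem coeff_of_mul_linS {F G : PowerSeries ℚ} {δ : ℚ} (hδ : δ ≠ 0) (h : F * linS δ = G) :
    coeff 0 F = coeff 0 G / δ ∧ coeff 1 F = (coeff 1 G - coeff 0 F) / δ ∧
      coeff 2 F = (coeff 2 G - coeff 1 F) / δ := by
  have h0 := coeff_zero_mul_linS F δ
  have h1 := coeff_succ_mul_linS F δ 0
  have h2 := coeff_succ_mul_linS F δ 1
  rw [h] at h0 h1 h2
  refine ⟨?_, ?_, ?_⟩
  · rw [h0]; field_simp
  · rw [h1]; field_simp; ring
  · rw [h2]; field_simp; ring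

omit hp in
/-- From `F·(X+δ)² = G` (`δ ≠ 0`): the first two coefficients of `F`. -/
theorem coeff_of_mul_linS_sq {F G : PowerSeries ℚ} {δ : ℚ} (hδ : δ ≠ 0) (h : F * linS δ ^ 2 = G) :
    coeff 0 F = coeff 0 G / δ ^ 2 ∧ coeff 1 F = coeff 1 G / δ ^ 2 - 2 * coeff 0 G / δ ^ 3 := by
  have hF1 : (F * linS δ) * linS δ = G := by rw [← h, pow_two, mul_assoc]
  obtain ⟨a0, a1, -⟩ := coeff_of_mul_linS hδ hF1
  obtain ⟨b0, b1, -⟩ := coeff_of_mul_linS hδ (rfl : F * linS δ = F * linS δ)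
  have e0 : coeff 0 F = coeff 0 G / δ ^ 2 := by rw [b0, a0]; field_simp
  refine ⟨e0, ?_⟩
  rw [b1, a1, a0, e0]
  field_simp
  ring

omit hp in
/-- From `F·(X+δ)³ = G` (`δ ≠ 0`): the constant coefficient of `F`. -/
theorem coeff_of_mul_linS_cube {F G : PowerSeries ℚ} {δ : ℚ} (hδ : δ ≠ 0) (h : F * linS δ ^ 3 = G) :
    coeff 0 F = coeff 0 G / δ ^ 3 := by
  have hF1 : (F * linS δ) * linS δ ^ 2 = G := by rw [← h]; ring
  obtain ⟨a0, -⟩ := coeff_of_mul_linS_sq hδ hF1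
  obtain ⟨b0, -⟩ := coeff_of_mul_linS hδ (rfl : F * linS δ = F * linS δ)
  rw [b0, a0]
  field_simp

/-! ### `Gout` has `p`-integral coefficients -/

/-- If no position `s ∉ {q, r}` of `[0, b₀]` is congruent to `q` modulo `p`, then `Gout b q r` has `p`-integral
coefficients (the centre factor is integral; every remaining linear factor has a unit constant term). -/
theorem gout_integral (b : ℕ → ℤ) {q r : ℕ} (hq : q ≤ (b 0).toNat) (hn : (b 0).toNat < p ^ 2) (hp2 : p ≠ 2)
    (hfar : ∀ s, s ≤ (b 0).toNat → s ≠ q → s ≠ r → ¬ (p : ℤ) ∣ (s : ℤ) - q) :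
    CoeffBound p 0 0 (Gout b q r) := by
  have hcen : CoeffBound p 0 0 (cenP b q : PowerSeries ℚ) := by
    unfold cenP
    split_ifs with hev
    · rw [Polynomial.coe_C]
      exact coeffBound_C (by simpa using padicNorm.of_nat (p := p) 2)
    · rw [Polynomial.coe_add, Polynomial.coe_mul, Polynomial.coe_C, Polynomial.coe_X, Polynomial.coe_C]
      refine coeffBound_two_X_add_C le_rfl hp2 ?_
      have hz : ((((b 0).toNat : ℕ) : ℚ) - 2 * q) = ((((b 0).toNat : ℤ) - 2 * q : ℤ) : ℚ) := by push_cast; ring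
      rw [hz, neg_zero, zpow_zero]
      exact padicNorm.of_int _
  have hprod : CoeffBound p 0 (∑ _s ∈ ((range ((b 0).toNat + 1)).erase q).erase r, (0 : ℤ))
      (∏ s ∈ ((range ((b 0).toNat + 1)).erase q).erase r, posFactor b q s) := by
    refine CoeffBound.prod _ _ _ fun s hs => ?_
    have hs' := mem_erase.1 hs
    have hs'' := mem_erase.1 hs'.2
    have hsn : s ≤ (b 0).toNat := Nat.lt_succ_iff.1 (mem_range.1 hs''.2)
    have hδ : ((s : ℚ) - q) ≠ 0 := sub_ne_zero.2 (by exact_mod_cast hs''.1)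
    have hdvd : ¬ (p : ℤ) ∣ (s : ℤ) - q := hfar s hsn hs''.1 hs'.1
    have hexact : padicNorm p ((s : ℚ) - q) = (p : ℚ) ^ (-(0 : ℤ)) := by
      have := padicNorm_sub_eq (p := p) hsn hq hs''.1 hn
      simpa [hdvd] using this
    have hlin : CoeffBound p 0 0 (linS ((s : ℚ) - q)) := coeffBound_X_add_C le_rfl hexact.le
    have h0 : padicNorm p (coeff 0 (linS ((s : ℚ) - q) ^ 6)) = (p : ℚ) ^ (-((6 : ℕ) * (0 : ℤ))) :=
      padicNorm_coeff_zero_pow (by rw [coeff_zero_linS]; exact hexact) 6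
    have hinv := (hlin.pow 6).of_mul_eq_one h0 (PowerSeries.mul_inv_cancel _
      (by rw [constantCoeff_linS_pow]; exact pow_ne_zero _ hδ))
    unfold posFactor
    simpa using (hlin.pow (mult b s)).mul hinv
  have h := hcen.mul hprod
  unfold Gout
  simpa using h

/-- A coefficient of `Gout` is `p`-integral. -/
theorem padicNorm_coeff_gout_le (b : ℕ → ℤ) {q r : ℕ} (hq : q ≤ (b 0).toNat) (hn : (b 0).toNat < p ^ 2)
    (hp2 : p ≠ 2) (hfar : ∀ s, s ≤ (b 0).toNat → s ≠ q → s ≠ r → ¬ (p : ℤ) ∣ (s : ℤ) - q) (k : ℕ) :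
    padicNorm p (coeff k (Gout b q r)) ≤ 1 :=
  (gout_integral b hq hn hp2 hfar).norm_le_one k

/-! ### The constant term of `Gout` and its congruence between the two points of a class -/

/-- The constant term of the centre factor at `q`: `2` (even `b₀`) or `b₀ − 2q` (odd `b₀`). -/
def cen0 (b : ℕ → ℤ) (q : ℕ) : ℚ := if (2 : ℤ) ∣ b 0 then 2 else (((b 0).toNat : ℕ) : ℚ) - 2 * q

omit hp in
/-- `[X⁰] cenP = cen0`. -/
theorem coeff_zero_cenP (b : ℕ → ℤ) (q : ℕ) : coeff 0 (cenP b q : PowerSeries ℚ) = cen0 b q := by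
  unfold cenP cen0
  split_ifs
  · rw [Polynomial.coeff_coe, Polynomial.coeff_C_zero]
  · rw [Polynomial.coeff_coe, Polynomial.coeff_add, Polynomial.coeff_C_mul, Polynomial.coeff_X_zero,
      Polynomial.coeff_C_zero, mul_zero, zero_add]

omit hp in
/-- `[X⁰] posFactor b q s = (s−q)^{mult s} · ((s−q)^6)⁻¹`. -/
theorem coeff_zero_posFactor (b : ℕ → ℤ) (q s : ℕ) :
    coeff 0 (posFactor b q s) = ((s : ℚ) - q) ^ mult b s * (((s : ℚ) - q) ^ 6)⁻¹ := by
  rw [posFactor, coeff_zero_eq_constantCoeff_apply, map_mul, PowerSeries.constantCoeff_inv,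
    constantCoeff_linS_pow, constantCoeff_linS_pow]

omit hp in
/-- **The constant term of `Gout`**: `[X⁰] Gout b q r = cen0 · ∏_{s ∉ {q,r}} (s−q)^{mult s}·((s−q)^6)⁻¹`. -/
theorem coeff_zero_gout (b : ℕ → ℤ) (q r : ℕ) :
    coeff 0 (Gout b q r) =
      cen0 b q * ∏ s ∈ ((range ((b 0).toNat + 1)).erase q).erase r,
        ((s : ℚ) - q) ^ mult b s * (((s : ℚ) - q) ^ 6)⁻¹ := by
  rw [Gout, coeff_zero_eq_constantCoeff_apply, map_mul, map_prod, ← coeff_zero_eq_constantCoeff_apply,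
    coeff_zero_cenP]
  congr 1
  exact prod_congr rfl fun s _ => by rw [← coeff_zero_eq_constantCoeff_apply, coeff_zero_posFactor]

/-- `‖x^m‖_p = ‖x‖_p^m`. -/
theorem padicNorm_pow_eq (x : ℚ) (m : ℕ) : padicNorm p (x ^ m) = padicNorm p x ^ m := by
  induction m with
  | zero => simp
  | succ k ih => rw [pow_succ, padicNorm.mul, ih, pow_succ]

/-- Powers of congruent `p`-adic integers are congruent. -/
theorem padicNorm_pow_sub_pow_le {u v : ℚ} (hu : padicNorm p u ≤ 1) (hv : padicNorm p v ≤ 1)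
    (huv : padicNorm p (u - v) ≤ (p : ℚ) ^ (-(1 : ℤ))) (m : ℕ) :
    padicNorm p (u ^ m - v ^ m) ≤ (p : ℚ) ^ (-(1 : ℤ)) := by
  induction m with
  | zero => simp only [pow_zero, sub_self, padicNorm.zero]; exact zpow_p_nonneg _
  | succ m ih =>
    have e : u ^ (m + 1) - v ^ (m + 1) = u ^ m * (u - v) + (u ^ m - v ^ m) * v := by ring
    rw [e]
    refine (padicNorm.nonarchimedean (p := p)).trans (max_le ?_ ?_)
    · rw [padicNorm.mul, padicNorm_pow_eq]
      calc padicNorm p u ^ m * padicNorm p (u - v) ≤ 1 * (p : ℚ) ^ (-(1 : ℤ)) :=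
            mul_le_mul (pow_le_one₀ (padicNorm.nonneg _) hu) huv (padicNorm.nonneg _) zero_le_one
        _ = _ := one_mul _
    · rw [padicNorm.mul]
      calc padicNorm p (u ^ m - v ^ m) * padicNorm p v ≤ (p : ℚ) ^ (-(1 : ℤ)) * 1 :=
            mul_le_mul ih hv (padicNorm.nonneg _) (zpow_p_nonneg _)
        _ = _ := mul_one _

/-- `‖x⁻¹‖_p = ‖x‖_p⁻¹`. -/
theorem padicNorm_inv' (x : ℚ) : padicNorm p x⁻¹ = (padicNorm p x)⁻¹ := by
  rw [inv_eq_one_div, padicNorm.div, padicNorm.one, one_div]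

/-- Inverses of congruent `p`-adic units are congruent. -/
theorem padicNorm_inv_sub_inv_le {u v : ℚ} (hu : padicNorm p u = 1) (hv : padicNorm p v = 1)
    (huv : padicNorm p (u - v) ≤ (p : ℚ) ^ (-(1 : ℤ))) :
    padicNorm p (u⁻¹ - v⁻¹) ≤ (p : ℚ) ^ (-(1 : ℤ)) := by
  have hu0 : u ≠ 0 := fun h => by rw [h, padicNorm.zero] at hu; exact zero_ne_one hu
  have hv0 : v ≠ 0 := fun h => by rw [h, padicNorm.zero] at hv; exact zero_ne_one hv
  have e : u⁻¹ - v⁻¹ = (v - u) / (u * v) := by field_simp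
  rw [e, padicNorm.div, padicNorm.mul, hu, hv, mul_one, div_one, ← padicNorm.neg, neg_sub]
  exact huv

/-- Products of congruent `p`-adic integers are congruent (two factors). -/
theorem padicNorm_mul_sub_mul_le {a a' c c' : ℚ} (ha : padicNorm p a ≤ 1) (hc' : padicNorm p c' ≤ 1)
    (haa : padicNorm p (a - a') ≤ (p : ℚ) ^ (-(1 : ℤ))) (hcc : padicNorm p (c - c') ≤ (p : ℚ) ^ (-(1 : ℤ))) :
    padicNorm p (a * c - a' * c') ≤ (p : ℚ) ^ (-(1 : ℤ)) := by
  have e : a * c - a' * c' = a * (c - c') + (a - a') * c' := by ring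
  rw [e]
  refine (padicNorm.nonarchimedean (p := p)).trans (max_le ?_ ?_)
  · rw [padicNorm.mul]
    calc padicNorm p a * padicNorm p (c - c') ≤ 1 * (p : ℚ) ^ (-(1 : ℤ)) :=
          mul_le_mul ha hcc (padicNorm.nonneg _) zero_le_one
      _ = _ := one_mul _
  · rw [padicNorm.mul]
    calc padicNorm p (a - a') * padicNorm p c' ≤ (p : ℚ) ^ (-(1 : ℤ)) * 1 :=
          mul_le_mul haa hc' (padicNorm.nonneg _) (zpow_p_nonneg _)
      _ = _ := mul_one _

/-- `‖∏ f‖_p ≤ 1` when every factor is `p`-integral. -/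
theorem padicNorm_prod_le_one {ι : Type*} (s : Finset ι) (f : ι → ℚ) (hf : ∀ i ∈ s, padicNorm p (f i) ≤ 1) :
    padicNorm p (∏ i ∈ s, f i) ≤ 1 := by
  classical
  induction s using Finset.induction_on with
  | empty => simp
  | insert a s ha ih =>
    rw [prod_insert ha, padicNorm.mul]
    calc padicNorm p (f a) * padicNorm p (∏ i ∈ s, f i) ≤ 1 * 1 :=
          mul_le_mul (hf a (mem_insert_self a s)) (ih fun i hi => hf i (mem_insert_of_mem hi))
            (padicNorm.nonneg _) zero_le_one
      _ = 1 := one_mul 1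

/-- Products of congruent `p`-adic integers are congruent (finite products). -/
theorem padicNorm_prod_sub_prod_le {ι : Type*} (s : Finset ι) (f g : ι → ℚ)
    (hf : ∀ i ∈ s, padicNorm p (f i) ≤ 1) (hg : ∀ i ∈ s, padicNorm p (g i) ≤ 1)
    (hfg : ∀ i ∈ s, padicNorm p (f i - g i) ≤ (p : ℚ) ^ (-(1 : ℤ))) :
    padicNorm p (∏ i ∈ s, f i - ∏ i ∈ s, g i) ≤ (p : ℚ) ^ (-(1 : ℤ)) := by
  classical
  induction s using Finset.induction_on with
  | empty => simp only [prod_empty, sub_self, padicNorm.zero]; exact zpow_p_nonneg _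
  | insert a s ha ih =>
    rw [prod_insert ha, prod_insert ha]
    exact padicNorm_mul_sub_mul_le (hf a (mem_insert_self a s))
      (padicNorm_prod_le_one s g fun i hi => hg i (mem_insert_of_mem hi))
      (hfg a (mem_insert_self a s)) (ih (fun i hi => hf i (mem_insert_of_mem hi))
        (fun i hi => hg i (mem_insert_of_mem hi)) (fun i hi => hfg i (mem_insert_of_mem hi)))

/-- The norm of `p` itself: `‖p‖_p = p⁻¹`. -/
theorem padicNorm_p : padicNorm p (p : ℚ) = (p : ℚ) ^ (-(1 : ℤ)) := by
  rw [padicNorm.padicNorm_p_of_prime, zpow_neg, zpow_one]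

/-- **Congruence of the constant terms of `Gout` at the two points `q₀`, `q₀ + p` of a class**
(all other positions being foreign to the class): `‖[X⁰]Gout b (q₀+p) q₀ − [X⁰]Gout b q₀ (q₀+p)‖_p ≤ p⁻¹`. -/
theorem padicNorm_goutConst_sub_le (b : ℕ → ℤ) {q₀ : ℕ} (hq₁ : q₀ + p ≤ (b 0).toNat)
    (hn : (b 0).toNat < p ^ 2)
    (hfar : ∀ s, s ≤ (b 0).toNat → s ≠ q₀ → s ≠ q₀ + p → ¬ (p : ℤ) ∣ (s : ℤ) - q₀) :
    padicNorm p (coeff 0 (Gout b (q₀ + p) q₀) - coeff 0 (Gout b q₀ (q₀ + p))) ≤ (p : ℚ) ^ (-(1 : ℤ)) := by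
  have hq₀ : q₀ ≤ (b 0).toNat := by omega
  rw [coeff_zero_gout, coeff_zero_gout, Finset.erase_right_comm]
  set S := ((range ((b 0).toNat + 1)).erase q₀).erase (q₀ + p) with hS
  -- data on the foreign positions
  have hmemS : ∀ s ∈ S, s ≤ (b 0).toNat ∧ s ≠ q₀ ∧ s ≠ q₀ + p := by
    intro s hs
    have h1 := mem_erase.1 hs
    have h2 := mem_erase.1 h1.2
    exact ⟨Nat.lt_succ_iff.1 (mem_range.1 h2.2), h2.1, h1.1⟩
  have hunit0 : ∀ s ∈ S, padicNorm p ((s : ℚ) - q₀) = 1 := by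
    intro s hs
    obtain ⟨hsn, hs0, hs1⟩ := hmemS s hs
    have := padicNorm_sub_eq (p := p) hsn hq₀ hs0 hn
    simpa [hfar s hsn hs0 hs1] using this
  have hunit1 : ∀ s ∈ S, padicNorm p ((s : ℚ) - ((q₀ + p : ℕ) : ℚ)) = 1 := by
    intro s hs
    obtain ⟨hsn, hs0, hs1⟩ := hmemS s hs
    have hdvd : ¬ (p : ℤ) ∣ (s : ℤ) - ((q₀ + p : ℕ) : ℤ) := by
      intro h
      apply hfar s hsn hs0 hs1
      have : (s : ℤ) - q₀ = ((s : ℤ) - ((q₀ + p : ℕ) : ℤ)) + p := by push_cast; ring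
      rw [this]; exact h.add (dvd_refl _)
    have := padicNorm_sub_eq (p := p) hsn hq₁ hs1 hn
    rw [if_neg hdvd] at this
    simpa using this
  have hdiff : ∀ s ∈ S, padicNorm p (((s : ℚ) - ((q₀ + p : ℕ) : ℚ)) - ((s : ℚ) - q₀)) ≤ (p : ℚ) ^ (-(1 : ℤ)) := by
    intro s _
    have e : ((s : ℚ) - ((q₀ + p : ℕ) : ℚ)) - ((s : ℚ) - q₀) = -(p : ℚ) := by push_cast; ring
    rw [e, padicNorm.neg, padicNorm_p]
  -- the centre constants
  have hcen : padicNorm p (cen0 b (q₀ + p) - cen0 b q₀) ≤ (p : ℚ) ^ (-(1 : ℤ)) := by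
    unfold cen0
    split_ifs
    · rw [sub_self, padicNorm.zero]; exact zpow_p_nonneg _
    · have e : ((((b 0).toNat : ℕ) : ℚ) - 2 * ((q₀ + p : ℕ) : ℚ)) - ((((b 0).toNat : ℕ) : ℚ) - 2 * q₀) =
          ((-2 : ℤ) : ℚ) * p := by push_cast; ring
      rw [e, padicNorm.mul, padicNorm_p]
      calc padicNorm p (((-2 : ℤ) : ℚ)) * (p : ℚ) ^ (-(1 : ℤ)) ≤ 1 * (p : ℚ) ^ (-(1 : ℤ)) :=
            mul_le_mul (padicNorm.of_int _) le_rfl (zpow_p_nonneg _) zero_le_one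
        _ = _ := one_mul _
  have hcenInt : ∀ q : ℕ, padicNorm p (cen0 b q) ≤ 1 := by
    intro q
    unfold cen0
    split_ifs
    · simpa using padicNorm.of_nat (p := p) 2
    · have e : ((((b 0).toNat : ℕ) : ℚ) - 2 * q) = ((((b 0).toNat : ℤ) - 2 * q : ℤ) : ℚ) := by push_cast; ring
      rw [e]; exact padicNorm.of_int _
  -- factorwise congruence
  have hfac_int : ∀ (u : ℚ), padicNorm p u = 1 → ∀ s : ℕ, padicNorm p (u ^ mult b s * (u ^ 6)⁻¹) ≤ 1 := by
    intro u hu s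
    rw [padicNorm.mul, padicNorm_inv', padicNorm_pow_eq, padicNorm_pow_eq, hu]; simp
  have hfac : ∀ s ∈ S,
      padicNorm p (((s : ℚ) - ((q₀ + p : ℕ) : ℚ)) ^ mult b s * ((((s : ℚ) - ((q₀ + p : ℕ) : ℚ))) ^ 6)⁻¹ -
        ((s : ℚ) - q₀) ^ mult b s * ((((s : ℚ) - q₀)) ^ 6)⁻¹) ≤ (p : ℚ) ^ (-(1 : ℤ)) := by
    intro s hs
    have hu := hunit1 s hs
    have hv := hunit0 s hs
    refine padicNorm_mul_sub_mul_le (by rw [padicNorm_pow_eq, hu]; simp)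
      (by rw [padicNorm_inv', padicNorm_pow_eq, hv]; simp)
      (padicNorm_pow_sub_pow_le hu.le hv.le (hdiff s hs) _) ?_
    exact padicNorm_inv_sub_inv_le (by rw [padicNorm_pow_eq, hu]; simp) (by rw [padicNorm_pow_eq, hv]; simp)
      (padicNorm_pow_sub_pow_le hu.le hv.le (hdiff s hs) 6)
  refine padicNorm_mul_sub_mul_le (hcenInt _) ?_ hcen ?_
  · exact padicNorm_prod_le_one S _ fun s hs => hfac_int _ (hunit0 s hs) s
  · exact padicNorm_prod_sub_prod_le S _ _ (fun s hs => hfac_int _ (hunit1 s hs) s)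
      (fun s hs => hfac_int _ (hunit0 s hs) s) hfac

end Summit.KontsevichZagierPeriods.Zeta5Search.CellA

end
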